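import Mathlib
import Summits.QuantumFields.YangMills.Theses.FemtoCutoffLadder
import Summits.QuantumFields.YangMills.Theorems.FemtoCutoffLadderLocalWallGlue
import Summits.QuantumFields.YangMills.Theorems.FemtoCutoffLadderLargeFieldInsensitivityRReductions

/-!
# SKELETON «local-wall» for the crux `LargeFieldInsensitivityR` (stmt-QuantumFields-26197, route `FemtoCutoffLadder` rev 18–20; rung R2b1 = RECORD label)

Lead seat `ym-line-fcl-p1` g9 (2026-08-28), registering — at the planner's request (ym-idea-1 g5, 06:54Z; ideator seats cannot
`skeleton check --crux`) — LINE g5-A «one plaquette wall at a time» as the skeleton OF RECORD of 26197 (critic idea-crit-4 07:03Z: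
PASS-WITH-PRICE).  ONE stub, the route child BY NAME:

* `stub_localWallStep : LocalWallStep` (stmt-QuantumFields-26282) — for every wall set `Q` of spatial plaquettes and one more plaquette
  `p₀ ∉ Q`, the `Q`-walled pair `(s, t)` (first-excited min–max value / top Rayleigh value over physical test functions vanishing on
  configurations with a κ-bad plaquette IN `Q`) of the SAME window transfer matrix moves, in the cross-multiplied `L`-th-power sense, by at
  most `exp(A/(β²N))`, `N = #Plaquette 3 L = 3L³`, uniformly in `(Q, p₀)`; and `t Q, t (Q ∪ {p₀}) > 0`.  XL (critic P3); it is a CANCELLATION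
  claim (critic P1: per-wall extensive shifts `−e^{−cβ^κ}(1+o(1))` of `log t`, `log s` must cancel down to the zero-mode imprint `O(β·L⁻⁴)`
  per plaquette — true iff the walled doublet stays the delocalised femto doublet for EVERY `Q`).  FIRST ATTACK (critic P2, planner rev 20):
  the two extreme wall sets, typed as supports `SingleWallStep` (26631, `Q = ∅`: one wall on the bare femto transfer matrix — perturbation
  theory around Lüscher's zero-mode Hamiltonian; kills the line cheaply if false: `not_localWallStep_of_not_singleWallStep`) and
  `LastWallStep` (26638, `Q = univ ∖ {p₀}`), both consequences of the stub (`…LocalWallStubs`, p613090).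
Composition (kernel-checked, in the TREE): `largeFieldInsensitivityR_of_localWallStep` (planner g5, p610789; Finset telescoping over an
enumeration of the `N` plaquettes, `C = 0`; `W ∅` = (topValue, secondValue) by `rfl`, `W univ` = B′'s SF_κ pair).
ALTERNATIVE line (lead g9, registered 07:3xZ as «beta-allowance», now the fallback): ONE stub B‴ = the GLOBAL two comparisons at slack
`e^{A/β²}` (`largeFieldInsensitivityR_of_betaAllowance`, p611095) — weaker than `LocalWallStep` (it is its telescoped consequence), without
the attackable first rung `SingleWallStep`.  PICKED: local-wall > beta-allowance (see PICKED.md).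
HONEST FRAMING: the stub is OPEN (no convergent expansion at window couplings; one-defect relative bounds for hard-wall compressions uniform over
`2^N` wall sets are not in print), behind `UVStabilityNonUniqueness`; R2b1 is a RECORD rung — not infinite volume, not a mass gap, not Clay.
No summit is proved by this line.
-/

set_option autoImplicit false

noncomputable section

open Summit.QuantumFields.YangMills.Theorems.FemtoTransferGap
open Summit.QuantumFields.YangMills.Theorems.FemtoCutoffLadder
open Summit.QuantumFields.YangMills.Theses.FemtoCutoffLadder

namespace Summit.QuantumFields.YangMills.Cruxes.LargeFieldInsensitivityR.LocalWall

/-- stub (the ONLY one; XL): the route child `LocalWallStep` (stmt-QuantumFields-26282) BY NAME. -/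
theorem stub_localWallStep : LocalWallStep := by
  sorry

/-- ★ The crux child `LargeFieldInsensitivityR` BY NAME from exactly the one declared stub (kernel-checked composition p610789:
`largeFieldInsensitivityR_of_localWallStep`). -/
theorem LargeFieldInsensitivityR_holds_of_stubs : LargeFieldInsensitivityR :=
  largeFieldInsensitivityR_of_localWallStep stub_localWallStep

end Summit.QuantumFields.YangMills.Cruxes.LargeFieldInsensitivityR.LocalWall

end
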